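import Mathlib.Analysis.SpecialFunctions.Log.Base
import Summits.MatrixMultiplication.MatrixMultiplication.Statement
import Summits.MatrixMultiplication.MatrixMultiplication.Theorems.SoloInformedSupportSum
import Literature.Computability.AlgebraicComplexity.CwLaserBlocks

/-!
# The s-rank door: `R̃_s(T_{cw,2}) ≤ 3 ⇒ ω = 2`, and the support-rank laser bound

Solo deliverable (informed mode). Cohn–Umans 2013 remark (p. 8) that "all manipulations … of
[CW] also work with s-rank in place of ordinary rank … these inequalities involving s-rank
eventually yield an s-rank bound [on `ω_s`]", and prove `ω ≤ (3ω_s − 2)/2` (Thm. 6, in the tree: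
`CohnUmans2013Thm6.omega_le_three_mul_omegaS_sub_two_div_two`). With the s-rank asymptotic sum
inequality of `SoloInformedSupportSum` (slot symmetrisation) we make this a kernel theorem in
growth form, for the simple Coppersmith–Winograd tensors `T_{cw,q}` (`cwTensor`, `q+1`
coordinates):

* `omegaS_le_logb_of_supportRank_laser` — abstract Layer 1 for `ω_s`: if `T^{⊗3m}` zeroes out
  to (a same-support image of) `⟨p_m⟩ ⊗ ⟨q^m,q^m,q^m⟩` with the Behrend-size `p_m`, and
  `R_s(T^{⊗N}) = O(ρ^{(1+ε)N})` for all `ε > 0`, then `ω_s ≤ log_q(4ρ³/27)`;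
* `omegaS_le_logb_of_supportRank_cw_growth` — for `T = T_{cw,q}`: **`R̃_s(T_{cw,q}) ≤ ρ ⇒
  ω_s ≤ log_q(4ρ³/27)`**, hence `ω ≤ (3 log_q(4ρ³/27) − 2)/2` (`omega_le_of_supportRank_cw_growth`);
* **the s-rank door** `matrixMultiplication_of_supportRank_cwTensor_two_growth`:
  `R_s(T_{cw,2}^{⊗N}) = O(3^{(1+ε)N})` for every `ε > 0` implies `ω = 2`; its width
  (`omega_lt_of_supportRank_cwTensor_two_growth`: base `ρ ≤ 3.16 ⇒ ω < 2.36 < 2.371339`);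
* it is the WEAKEST door of the carrier family: the growth hypothesis for the RANK of the powers of
  ANY tensor with the support of `T_{cw,2}` (all carriers `T_μ`, `T_{1,1,Γ₂}`, …) implies it
  (`supportRank_growth_of_sameSupport_rank_growth`), since `R_s(T'^{⊗N}) ≤ R(T^{⊗N})` whenever
  `supp T' = supp T`.

Zeroing out is support-faithful (`cw_kroneckerPow_blocks` is an identity of entries along index
maps), which is why the laser method survives the passage to s-rank; the one non-literal step is
the asymptotic sum inequality, repaired in `SoloInformedSupportSum`.

[cite: CohnUmans2013, Thm. 6, Prop. 5, §3 p. 8 and §5 eq. (s-rank-asi)]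
[cite: BurgisserClausenShokrollahi1997, Thm. 15.41 (proof, pp. 380–383) and Ex. 15.24(7)]
-/

noncomputable section

open scoped BigOperators
open Filter Asymptotics Finset

namespace Summit.MatrixMultiplication.MatrixMultiplication.Theorems.SupportRankDoor

open Literature.Computability.AlgebraicComplexity

universe u

/-! ## Same support under powers; the s-ASI in s-rank form -/

section Support

variable {K : Type u} [Field K] {ι κ μ : Type}

/-- Same support is symmetric. [cite: CohnUmans2013, Def. 1] -/
theorem sameSupport_symm {t t' : ι → κ → μ → K} (h : SameSupport t t') : SameSupport t' t :=
  fun i j k => (h i j k).symm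

/-- Same support passes to tensor powers (entrywise products). [cite: CohnUmans2013, Def. 1] -/
theorem sameSupport_kroneckerPow {t t' : ι → κ → μ → K} (h : SameSupport t t') (N : ℕ) :
    SameSupport (kroneckerPow t N) (kroneckerPow t' N) := by
  intro a b c
  simp only [kroneckerPow_apply, prod_ne_zero_iff]
  exact forall₂_congr fun i _ => h (a i) (b i) (c i)

variable [Fintype ι] [Fintype κ] [Fintype μ]

/-- `R_s(T'^{⊗N}) ≤ R(T^{⊗N})` whenever `supp T' = supp T`: every same-support carrier's rank
growth bounds the s-rank growth. [cite: CohnUmans2013, §3 (after Def. 1)] -/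
theorem supportRank_kroneckerPow_le_of_sameSupport {t t' : ι → κ → μ → K}
    (h : SameSupport t' t) (N : ℕ) :
    supportRank (kroneckerPow t' N) ≤ tensorRank (kroneckerPow t N) :=
  supportRank_le_of_sameSupport (sameSupport_kroneckerPow h N) le_rfl

/-- **Weakest door.** If `R(T^{⊗N}) = O(ρ^{(1+ε)N})` for all `ε > 0` (i.e. `R̃(T) ≤ ρ`) for SOME
tensor `T` with the support of `T'`, then `R_s(T'^{⊗N}) = O(ρ^{(1+ε)N})` for all `ε > 0`.
[cite: CohnUmans2013, §3 (after Def. 1)] -/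
theorem supportRank_growth_of_sameSupport_rank_growth {t t' : ι → κ → μ → ℂ}
    (h : SameSupport t' t) {ρ : ℝ}
    (hyp : ∀ ε : ℝ, 0 < ε → (fun N : ℕ => (tensorRank (kroneckerPow t N) : ℝ)) =O[atTop]
      fun N : ℕ => ρ ^ ((1 + ε) * N)) (ε : ℝ) (hε : 0 < ε) :
    (fun N : ℕ => (supportRank (kroneckerPow t' N) : ℝ)) =O[atTop]
      fun N : ℕ => ρ ^ ((1 + ε) * N) := by
  refine IsBigO.trans (IsBigO.of_bound 1 (Eventually.of_forall fun N => ?_)) (hyp ε hε)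
  rw [one_mul, Real.norm_of_nonneg (Nat.cast_nonneg _), Real.norm_of_nonneg (Nat.cast_nonneg _)]
  exact_mod_cast supportRank_kroneckerPow_le_of_sameSupport h N

/-- **s-rank asymptotic sum inequality, s-rank form**: `P · Q^{ω_s} ≤ R_s(⟨P⟩ ⊗ ⟨Q,Q,Q⟩)`
(`P ≥ 1`, `Q ≥ 2`). [cite: CohnUmans2013, §5 eq. (s-rank-asi)] -/
theorem mul_rpow_omegaS_le_supportRank {P Q : ℕ} (hP : 1 ≤ P) (hQ : 2 ≤ Q) :
    (P : ℝ) * (Q : ℝ) ^ omegaS K ≤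
      supportRank (kroneckerTensor (unitTensor K P) (matMulTensor K Q Q Q)) := by
  obtain ⟨D, hD, hDr⟩ :=
    exists_sameSupport_tensorRank_eq (kroneckerTensor (unitTensor K P) (matMulTensor K Q Q Q))
  rw [← hDr]
  exact mul_rpow_omegaS_le_tensorRank hP hQ D hD

end Support

/-! ## Layer 1 for `ω_s` -/

/-- (E3) of the laser method: the Behrend-size block count satisfies
`log p_m ≥ m log(27/4) − 12√m − log 96` (`C(3m,m) ≥ (27/4)^m/(3m+1)`, `C(2m,m) ≤ 4^m`, Behrend).
[cite: BurgisserClausenShokrollahi1997, Thm. 15.41 (proof, p. 381)] -/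
theorem log_blockCount_lower {m p : ℕ} (hm : 1 ≤ m)
    (hsize : (3 * m).choose m * rothNumberNat (3 * (2 * m).choose m) ≤ 288 * (2 * m).choose m * p) :
    0 < (p : ℝ) ∧ (m : ℝ) * Real.log (27 / 4) - 12 * √(m : ℝ) - Real.log 96 ≤ Real.log p := by
  have hlog3 : Real.log 3 ≤ 2 := by
    rw [Real.log_le_iff_le_exp (by norm_num)]; linarith [exp_two_gt]
  have hlog4 : Real.log 4 ≤ 2 := by
    rw [Real.log_le_iff_le_exp (by norm_num)]; linarith [exp_two_gt]
  set f := (2 * m).choose m with hf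
  have hf1 : 1 ≤ f := Nat.choose_pos (by omega)
  have hf4 : (f : ℝ) ≤ 4 ^ m := by
    have : f ≤ 2 ^ (2 * m) := Nat.choose_le_two_pow _ _
    calc (f : ℝ) ≤ ((2 ^ (2 * m) : ℕ) : ℝ) := by exact_mod_cast this
      _ = 4 ^ m := by push_cast; rw [pow_mul]; norm_num
  have hB := Behrend.roth_lower_bound (N := 3 * f)
  have hsize' : ((3 * m).choose m : ℝ) * rothNumberNat (3 * f) ≤ 288 * f * p := by
    exact_mod_cast hsize
  set s : ℝ := 4 * √(Real.log ((3 * f : ℕ) : ℝ)) with hs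
  have hexp : 0 < Real.exp (-s) := Real.exp_pos _
  have hB' : ((3 * f : ℕ) : ℝ) * Real.exp (-s) ≤ rothNumberNat (3 * f) := by
    rw [hs, show -(4 * √(Real.log ((3 * f : ℕ) : ℝ))) = -4 * √(Real.log ((3 * f : ℕ) : ℝ)) by ring]
    exact hB
  have hC0 : (0 : ℝ) ≤ (3 * m).choose m := Nat.cast_nonneg _
  have h1 : ((3 * m).choose m : ℝ) * Real.exp (-s) ≤ 96 * p := by
    have h3f : (0 : ℝ) < ((3 * f : ℕ) : ℝ) := by positivity
    refine le_of_mul_le_mul_right ?_ h3f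
    calc ((3 * m).choose m : ℝ) * Real.exp (-s) * ((3 * f : ℕ) : ℝ)
        = ((3 * m).choose m : ℝ) * (((3 * f : ℕ) : ℝ) * Real.exp (-s)) := by ring
      _ ≤ ((3 * m).choose m : ℝ) * rothNumberNat (3 * f) := mul_le_mul_of_nonneg_left hB' hC0
      _ ≤ 288 * f * p := hsize'
      _ = 96 * p * ((3 * f : ℕ) : ℝ) := by push_cast; ring
  have hP0 : 0 < (p : ℝ) := by
    have : 0 < ((3 * m).choose m : ℝ) * Real.exp (-s) :=
      mul_pos (by exact_mod_cast Nat.choose_pos (by omega)) hexp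
    linarith
  refine ⟨hP0, ?_⟩
  have h2 : ((27 : ℝ) / 4) ^ m * Real.exp (-s) ≤ 96 * (3 * m + 1) * p := by
    calc ((27 : ℝ) / 4) ^ m * Real.exp (-s)
        ≤ (3 * m + 1) * ((3 * m).choose m : ℝ) * Real.exp (-s) :=
          mul_le_mul_of_nonneg_right (pow_le_mul_choose_three_mul m) hexp.le
      _ = (3 * m + 1) * (((3 * m).choose m : ℝ) * Real.exp (-s)) := by ring
      _ ≤ (3 * m + 1) * (96 * p) := mul_le_mul_of_nonneg_left h1 (by positivity)
      _ = 96 * (3 * m + 1) * p := by ring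
  have h3 : (m : ℝ) * Real.log (27 / 4) - s ≤ Real.log 96 + Real.log (3 * m + 1) + Real.log p := by
    have hlhs : Real.log (((27 : ℝ) / 4) ^ m * Real.exp (-s)) = m * Real.log (27 / 4) - s := by
      rw [Real.log_mul (by positivity) hexp.ne', Real.log_pow, Real.log_exp]; ring
    have hrhs : Real.log (96 * (3 * m + 1) * p) =
        Real.log 96 + Real.log (3 * m + 1) + Real.log p := by
      rw [Real.log_mul (by positivity) hP0.ne', Real.log_mul (by norm_num) (by positivity)]
    rw [← hlhs, ← hrhs]
    exact Real.log_le_log (by positivity) h2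
  have hs8 : s ≤ 8 * √(m : ℝ) := by
    have hlog3f : Real.log ((3 * f : ℕ) : ℝ) ≤ 4 * m := by
      have hm1 : (1 : ℝ) ≤ m := by exact_mod_cast hm
      have : ((3 * f : ℕ) : ℝ) ≤ 3 * 4 ^ m := by push_cast; linarith
      calc Real.log ((3 * f : ℕ) : ℝ) ≤ Real.log (3 * 4 ^ m) :=
            Real.log_le_log (by positivity) this
        _ = Real.log 3 + m * Real.log 4 := by
            rw [Real.log_mul (by norm_num) (by positivity), Real.log_pow]
        _ ≤ 2 + m * 2 := by nlinarith
        _ ≤ 4 * m := by linarith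
    have : √(Real.log ((3 * f : ℕ) : ℝ)) ≤ 2 * √(m : ℝ) := by
      calc √(Real.log ((3 * f : ℕ) : ℝ)) ≤ √(4 * m) := Real.sqrt_le_sqrt hlog3f
        _ = 2 * √(m : ℝ) := by
            rw [Real.sqrt_mul (by norm_num), show (4 : ℝ) = 2 ^ 2 by norm_num,
              Real.sqrt_sq (by norm_num)]
    rw [hs]; linarith
  have hl4 : Real.log (3 * m + 1) ≤ 4 * √(m : ℝ) := by
    calc Real.log (3 * m + 1) ≤ 2 * √(3 * m + 1) := log_le_two_mul_sqrt (by positivity)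
      _ ≤ 2 * √(4 * m) := by
          have hm1 : (1 : ℝ) ≤ m := by exact_mod_cast hm
          exact mul_le_mul_of_nonneg_left (Real.sqrt_le_sqrt (by linarith)) (by norm_num)
      _ = 4 * √(m : ℝ) := by
          rw [Real.sqrt_mul (by norm_num), show (4 : ℝ) = 2 ^ 2 by norm_num,
            Real.sqrt_sq (by norm_num)]; ring
  linarith

/-- **Layer 1 for `ω_s`** (Cohn–Umans 2013, p. 8: the manipulations of [CW] "also work with s-rank
in place of ordinary rank"): let `T` be a tensor over `ℂ`, `q ≥ 2`, `ρ > 0`, such that for every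
`m ≥ 1`, `R_s(⟨p_m⟩ ⊗ ⟨q^m,q^m,q^m⟩) ≤ R_s(T^{⊗3m})` for some Behrend-size `p_m` (e.g. a
zeroing-out), and `R_s(T^{⊗N}) = O(ρ^{(1+ε)N})` for every `ε > 0`. Then `ω_s ≤ log_q(4ρ³/27)`.
(s-ASI: `p_m q^{m ω_s} ≤ R_s(T^{⊗3m})`; (E3); logarithms; `m → ∞`; `ε → 0`.)
[cite: CohnUmans2013, §3 p. 8 and Thm. 6] -/
theorem omegaS_le_logb_of_supportRank_laser {ι κ μ : Type} [Fintype ι] [Fintype κ] [Fintype μ]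
    (T : ι → κ → μ → ℂ) (q : ℕ) (hq : 2 ≤ q) (ρ : ℝ) (hρ : 0 < ρ)
    (hres : ∀ m : ℕ, 1 ≤ m → ∃ p : ℕ,
        (3 * m).choose m * rothNumberNat (3 * (2 * m).choose m) ≤ 288 * (2 * m).choose m * p ∧
        supportRank (kroneckerTensor (unitTensor ℂ p) (matMulTensor ℂ (q ^ m) (q ^ m) (q ^ m)))
          ≤ supportRank (kroneckerPow T (3 * m)))
    (hyp : ∀ ε : ℝ, 0 < ε →
      (fun N : ℕ => (supportRank (kroneckerPow T N) : ℝ)) =O[atTop]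
        fun N : ℕ => ρ ^ ((1 + ε) * N)) :
    omegaS ℂ ≤ Real.logb q (4 * ρ ^ 3 / 27) := by
  have hq1 : (1 : ℝ) < q := by exact_mod_cast hq
  have hq0 : (0 : ℝ) < q := by positivity
  have hlogq : 0 < Real.log q := Real.log_pos hq1
  have hω2 : 2 ≤ omegaS ℂ := omegaS_two_le ℂ
  set L : ℝ := Real.log (27 / 4) with hL
  -- MAIN CLAIM: for all `ε > 0`, `L + ω_s log q ≤ 3 (1+ε) log ρ`
  have main : ∀ ε : ℝ, 0 < ε → L + omegaS ℂ * Real.log q ≤ 3 * (1 + ε) * Real.log ρ := by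
    intro ε hε
    obtain ⟨Cε, hCε, hb⟩ := bound_of_isBigO_nat_atTop (hyp ε hε)
    have hrank : ∀ N : ℕ, (supportRank (kroneckerPow T N) : ℝ) ≤ Cε * ρ ^ ((1 + ε) * N) := by
      intro N
      have hg : ρ ^ ((1 + ε) * N) ≠ 0 := (Real.rpow_pos_of_pos hρ _).ne'
      have := hb hg
      rwa [Real.norm_of_nonneg (Nat.cast_nonneg _),
        Real.norm_of_nonneg (Real.rpow_pos_of_pos hρ _).le] at this
    choose! P hPsize hPres using hres
    refine le_of_forall_large_mul_le (c := 12) (c' := Real.log 96 + Real.log Cε)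
      ⟨1, fun m hm => ?_⟩
    obtain ⟨hP0, hlogP⟩ := log_blockCount_lower hm (hPsize m hm)
    have hP1 : 1 ≤ P m := by exact_mod_cast hP0
    have hqm : (2 : ℕ) ≤ q ^ m := le_trans hq (Nat.le_self_pow (by omega) q)
    -- s-ASI at level `m`: `P m · (q^m)^{ω_s} ≤ R_s(T^{⊗3m}) ≤ Cε ρ^{(1+ε)3m}`
    have hE1 : (P m : ℝ) * ((q : ℝ) ^ m) ^ omegaS ℂ ≤ Cε * ρ ^ ((1 + ε) * ((3 * m : ℕ) : ℝ)) := by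
      have h := mul_rpow_omegaS_le_supportRank (K := ℂ) hP1 hqm
      push_cast at h
      exact h.trans ((by exact_mod_cast hPres m hm : (supportRank (kroneckerTensor
        (unitTensor ℂ (P m)) (matMulTensor ℂ (q ^ m) (q ^ m) (q ^ m))) : ℝ) ≤
        supportRank (kroneckerPow T (3 * m))).trans (hrank (3 * m)))
    have hE1' : Real.log (P m) + omegaS ℂ * (m * Real.log q) ≤
        Real.log Cε + (1 + ε) * (3 * m) * Real.log ρ := by
      have hpos : (0 : ℝ) < (P m : ℝ) * ((q : ℝ) ^ m) ^ omegaS ℂ := by positivity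
      have hl := Real.log_le_log hpos hE1
      rw [Real.log_mul hP0.ne' (by positivity), Real.log_rpow (by positivity), Real.log_pow,
        Real.log_mul hCε.ne' (Real.rpow_pos_of_pos hρ _).ne', Real.log_rpow hρ] at hl
      have h3 : ((3 * m : ℕ) : ℝ) = 3 * m := by push_cast; ring
      rw [h3] at hl
      linarith
    nlinarith [hE1', hlogP]
  -- `ε → 0`
  have key : L + omegaS ℂ * Real.log q ≤ 3 * Real.log ρ := by
    refine le_of_forall_pos_le_add fun η hη => ?_
    set ε : ℝ := η / (3 * |Real.log ρ| + 1) with hε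
    have hε0 : 0 < ε := by positivity
    have h := main ε hε0
    have h1 : 3 * ε * Real.log ρ ≤ η := by
      calc 3 * ε * Real.log ρ ≤ 3 * ε * |Real.log ρ| :=
            mul_le_mul_of_nonneg_left (le_abs_self _) (by positivity)
        _ = η * (3 * |Real.log ρ| / (3 * |Real.log ρ| + 1)) := by rw [hε]; field_simp
        _ ≤ η * 1 := by
            refine mul_le_mul_of_nonneg_left ?_ hη.le
            rw [div_le_one (by positivity)]; linarith
        _ = η := mul_one _
    nlinarith
  have hy : 0 < 4 * ρ ^ 3 / 27 := by positivity
  rw [Real.le_logb_iff_rpow_le hq1 hy, ← Real.log_le_log_iff (Real.rpow_pos_of_pos hq0 _) hy,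
    Real.log_rpow hq0]
  have : Real.log (4 * ρ ^ 3 / 27) = 3 * Real.log ρ - L := by
    rw [hL, Real.log_div (by positivity) (by norm_num), Real.log_mul (by norm_num) (by positivity),
      Real.log_pow, Real.log_div (by norm_num) (by norm_num)]
    push_cast; ring
  rw [this]
  linarith

/-! ## The Coppersmith–Winograd tensors -/

/-- Zeroing out is support-faithful: `R_s(⟨|Δ|⟩ ⊗ ⟨q^m,q^m,q^m⟩) ≤ R_s(T_{cw,q}^{⊗3m})` with the
Behrend-size `|Δ|` (`cw_kroneckerPow_blocks` is an identity of entries along index maps, and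
`R_s` does not increase under index maps).
[cite: BurgisserClausenShokrollahi1997, Thm. 15.41 (proof, p. 381)] -/
theorem exists_supportRank_blocks_le_cw (K : Type u) [Field K] (q m : ℕ) (hm : 1 ≤ m) :
    ∃ p : ℕ, (3 * m).choose m * rothNumberNat (3 * (2 * m).choose m) ≤ 288 * (2 * m).choose m * p ∧
      supportRank (kroneckerTensor (unitTensor K p) (matMulTensor K (q ^ m) (q ^ m) (q ^ m))) ≤
        supportRank (kroneckerPow (cwTensor K q) (3 * m)) := by
  classical
  obtain ⟨Δ, hcard, hpart, hfree, hsize⟩ := exists_free_balanced_diagonal m hm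
  obtain ⟨F, G, H, hFGH⟩ := cw_kroneckerPow_blocks K q m (3 * m) Δ hcard hpart hfree
  refine ⟨Δ.card, hsize, ?_⟩
  rw [hFGH]
  exact supportRank_precomp_le _ F G H

/-- **`R̃_s(T_{cw,q}) ≤ ρ ⇒ ω_s ≤ log_q(4ρ³/27)`** (growth form): the Coppersmith–Winograd bound
survives the passage from rank to support rank. [cite: CohnUmans2013, §3 p. 8] -/
theorem omegaS_le_logb_of_supportRank_cw_growth {q : ℕ} (hq : 2 ≤ q) {ρ : ℝ} (hρ : 0 < ρ)
    (hyp : ∀ ε : ℝ, 0 < ε →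
      (fun N : ℕ => (supportRank (kroneckerPow (cwTensor ℂ q) N) : ℝ)) =O[atTop]
        fun N : ℕ => ρ ^ ((1 + ε) * N)) :
    omegaS ℂ ≤ Real.logb q (4 * ρ ^ 3 / 27) :=
  omegaS_le_logb_of_supportRank_laser (cwTensor ℂ q) q hq ρ hρ
    (fun m hm => exists_supportRank_blocks_le_cw ℂ q m hm) hyp

/-- **`R̃_s(T_{cw,q}) ≤ ρ ⇒ ω ≤ (3 log_q(4ρ³/27) − 2)/2`** (with Cohn–Umans Thm. 6,
`ω ≤ (3ω_s − 2)/2`). [cite: CohnUmans2013, Thm. 6] -/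
theorem omega_le_of_supportRank_cw_growth {q : ℕ} (hq : 2 ≤ q) {ρ : ℝ} (hρ : 0 < ρ)
    (hyp : ∀ ε : ℝ, 0 < ε →
      (fun N : ℕ => (supportRank (kroneckerPow (cwTensor ℂ q) N) : ℝ)) =O[atTop]
        fun N : ℕ => ρ ^ ((1 + ε) * N)) :
    omega ℂ ≤ (3 * Real.logb q (4 * ρ ^ 3 / 27) - 2) / 2 := by
  have h1 := CohnUmans2013Thm6.omega_le_three_mul_omegaS_sub_two_div_two (K := ℂ)
  have h2 := omegaS_le_logb_of_supportRank_cw_growth hq hρ hyp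
  linarith

/-! ## The s-rank door for `T_{cw,2}` -/

/-- **The s-rank door.** If `R_s(T_{cw,2}^{⊗N}) = O(3^{(1+ε)N})` for every `ε > 0` — i.e. the
asymptotic SUPPORT rank of the small Coppersmith–Winograd tensor is `3` — then `ω = 2`
(`ω_s ≤ log₂(4·27/27) = 2`, `ω ≤ (3·2 − 2)/2 = 2`, `ω ≥ 2`).
[cite: CohnUmans2013, Thm. 6 and §3 p. 8] -/
theorem matrixMultiplication_of_supportRank_cwTensor_two_growth
    (hyp : ∀ ε : ℝ, 0 < ε →
      (fun N : ℕ => (supportRank (kroneckerPow (cwTensor ℂ 2) N) : ℝ)) =O[atTop]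
        fun N : ℕ => (3 : ℝ) ^ ((1 + ε) * N)) : _root_.MatrixMultiplication := by
  have h := omega_le_of_supportRank_cw_growth (le_refl 2) (by norm_num : (0 : ℝ) < 3) hyp
  have hlog : Real.logb (2 : ℕ) (4 * (3 : ℝ) ^ 3 / 27) = 2 := by
    rw [show (4 * (3 : ℝ) ^ 3 / 27) = (2 : ℝ) ^ (2 : ℝ) by norm_num]
    push_cast
    exact Real.logb_rpow (by norm_num) (by norm_num)
  rw [hlog] at h
  exact _root_.MatrixMultiplication_iff.2 (le_antisymm (by linarith) (omega_two_le ℂ))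

/-- The rank door is a special case: `R̃(T) ≤ 3` (growth form) for ANY tensor `T` with the support
of `T_{cw,2}` — `T_{cw,2}` itself, or any re-weighting of its six support points — implies `ω = 2`.
[cite: ConnerGesmundoLandsbergVentura2022, Thm. 1.1 and p. 3] -/
theorem matrixMultiplication_of_sameSupport_cwTensor_two_rank_growth {T : Fin 3 → Fin 3 → Fin 3 → ℂ}
    (hT : SameSupport (cwTensor ℂ 2) T)
    (hyp : ∀ ε : ℝ, 0 < ε →
      (fun N : ℕ => (tensorRank (kroneckerPow T N) : ℝ)) =O[atTop]
        fun N : ℕ => (3 : ℝ) ^ ((1 + ε) * N)) : _root_.MatrixMultiplication :=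
  matrixMultiplication_of_supportRank_cwTensor_two_growth
    (supportRank_growth_of_sameSupport_rank_growth hT hyp)

/-- The numerical inequality `log₂(4 · 3.16³/27) < 2.24` (`4·3.16³/27 = 4.674… < 2^{2.24} =
4.724…`), proved exactly via `(4·3.16³/27)^25 < 2^56`. -/
theorem logb_two_sLaser_bound_lt : Real.logb 2 (4 * (3.16 : ℝ) ^ 3 / 27) < 2.24 := by
  have hx : (0 : ℝ) < 4 * (3.16 : ℝ) ^ 3 / 27 := by norm_num
  rw [Real.logb_lt_iff_lt_rpow one_lt_two hx]
  have hy : (0 : ℝ) ≤ (2 : ℝ) ^ (2.24 : ℝ) := Real.rpow_nonneg (by norm_num) _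
  refine lt_of_pow_lt_pow_left₀ 25 hy ?_
  have h2 : ((2 : ℝ) ^ (2.24 : ℝ)) ^ 25 = 2 ^ 56 := by
    rw [← Real.rpow_natCast, ← Real.rpow_mul (by norm_num : (0 : ℝ) ≤ 2),
      show (2.24 : ℝ) * ((25 : ℕ) : ℝ) = ((56 : ℕ) : ℝ) by norm_num, Real.rpow_natCast]
  rw [h2]
  norm_num

/-- **Width of the s-rank door.** `R_s(T_{cw,2}^{⊗N}) = O(ρ^{(1+ε)N})` with `ρ ≤ 3.16` implies
`ω < 2.36`, below every upper bound on `ω` known in 2026 (`2.371339`); the known range is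
`R̃_s(T_{cw,2}) ∈ [3, 3.9310…]` (lower: `R_s ≥` flattening rank `3^N`... upper: every carrier).
[cite: AlmanDuanVassilevskaWilliamsXuXuZhou2025] -/
theorem omega_lt_of_supportRank_cwTensor_two_growth {ρ : ℝ} (hρ : 0 < ρ) (hρ' : ρ ≤ 3.16)
    (hyp : ∀ ε : ℝ, 0 < ε →
      (fun N : ℕ => (supportRank (kroneckerPow (cwTensor ℂ 2) N) : ℝ)) =O[atTop]
        fun N : ℕ => ρ ^ ((1 + ε) * N)) : omega ℂ < 2.36 := by
  have h := omega_le_of_supportRank_cw_growth (le_refl 2) hρ hyp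
  have hmono : Real.logb (2 : ℕ) (4 * ρ ^ 3 / 27) ≤ Real.logb 2 (4 * (3.16 : ℝ) ^ 3 / 27) := by
    push_cast
    exact Real.logb_le_logb_of_le one_lt_two (by positivity) (by gcongr)
  have hlt := logb_two_sLaser_bound_lt
  push_cast at h
  linarith

end Summit.MatrixMultiplication.MatrixMultiplication.Theorems.SupportRankDoor
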